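import Mathlib
import HarnessLib
import Literature.Computability.AlgebraicComplexity.ArithCircuit
import Literature.Computability.AlgebraicComplexity.ArithCircuitProofs
import Literature.Computability.AlgebraicComplexity.SupportSymmetrisation
import Summits.ValiantsHypothesis.ValiantsHypothesis.Theorems.MonotoneRestorationMonotoneRestorationQPRowScanAppend
import Summits.ValiantsHypothesis.ValiantsHypothesis.Theorems.MonotoneRestorationMonotoneRestorationQPRowScanBlocks

/-!
# ValiantsHypothesis / MonotoneRestoration — `MonotoneRestorationQP`, line `Sketch`, stub D4 (3/3)

Support file for crux item `stmt-ValiantsHypothesis-15886`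
(`Summit.ValiantsHypothesis.ValiantsHypothesis.Theses.MonotoneRestoration.MonotoneRestorationQP`),
line `Sketch`, stub `stub_rowScan_program`: **Theorem δ, the GLOBAL BLOCK of the scan program.**

Given the ROW BLOCKS `L` of a row scan (D3: an admissible annotated gate list of support width
`≤ 2` together with an index map locating the entries of the matrix powers `A_i^{k+1}` of the
transfer matrices `A_i = (H_{ab}(p_1(r_i), …, p_D(r_i)))_{ab}` at support `{i}`), we append, all at
support `∅`:

1. the power-sum matrices `P_{k+1} = Σ_i A_i^{k+1}` (`rowScanProg_blockP`);
2. the identity `E_0` and Newton's recursion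
   `E_m = Σ_{i<m} Σ_c ((-1)^i / m) (E_{m-1-i})_{ac} (P_{i+1})_{cb}` (`rowScanProg_blockE`), for the
   solution `E` defined by strong recursion — exported in the form
   `m • E_m = Σ_{i<m} (-1)^i E_{m-1-i} P_{i+1}` (`rowScanProg_newton`) consumed by D2;
3. the output gate `Σ_{a,b} (u_a v_b) • (E_n)_{ab}`.

The result is a supported program in the hypothesis format of
`SupportSymm.exists_symmetric_circuit_of_supports` (`k = 2`, fan-in
`≤ (n + w + 1)² + D + T + Eh`, at most `(n + w + 2)^6` new gates) computing `u · E_n · v`.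

References: I. G. Macdonald, *Symmetric Functions and Hall Polynomials*, 2nd ed., OUP 1995,
I.(2.11') (Newton's identities); P. Bürgisser, *Completeness and Reduction in Algebraic
Complexity Theory*, Springer 2000, Def. 2.1.
-/

-- `Summit.ValiantsHypothesis.ValiantsHypothesis.…` is the tree's mandated single-conjunct layout
-- (Sub = Summit), so the duplicated namespace component is intended.
set_option linter.dupNamespace false

noncomputable section

namespace Summit.ValiantsHypothesis.ValiantsHypothesis.Theorems

open Literature.Computability.AlgebraicComplexity

/-! ### Newton's recursion in matrix form -/

/-- The entrywise recursion `(E_k)_{ab} = Σ_{i<k} Σ_c ((-1)^i / k) (E_{k-1-i})_{ac} (P_{i+1})_{cb}`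
is Newton's recursion `k • E_k = Σ_{i<k} (-1)^i E_{k-1-i} P_{i+1}` (the scalar `k : ℚ` acting
through `ℂ`). [cite: Macdonald1995, I.(2.11')] -/
theorem rowScanProg_newton {n w : ℕ}
    (E Pm : ℕ → Matrix (Fin w) (Fin w) (MvPolynomial (Fin n × Fin n) ℂ))
    (hE : ∀ m, 1 ≤ m → m ≤ n → ∀ a b, E m a b = ∑ ic : Fin m × Fin w,
      ((-1 : ℂ) ^ (ic.1 : ℕ) / (m : ℂ)) • (E (m - 1 - ic.1) a ic.2 * Pm ic.1 ic.2 b))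
    (k : ℕ) (hk : 1 ≤ k) (hkn : k ≤ n) :
    (k : ℚ) • E k = ∑ i ∈ Finset.range k,
      (-1 : Matrix (Fin w) (Fin w) (MvPolynomial (Fin n × Fin n) ℂ)) ^ i * E (k - 1 - i) *
        Pm i := by
  have hk0 : (k : ℂ) ≠ 0 := Nat.cast_ne_zero.mpr (by omega)
  have hneg : ∀ (i : ℕ) (M : Matrix (Fin w) (Fin w) (MvPolynomial (Fin n × Fin n) ℂ)),
      (-1 : Matrix (Fin w) (Fin w) (MvPolynomial (Fin n × Fin n) ℂ)) ^ i * M =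
        ((-1 : ℂ) ^ i) • M := by
    intro i M
    rw [← neg_one_smul ℂ (1 : Matrix (Fin w) (Fin w) (MvPolynomial (Fin n × Fin n) ℂ)),
      smul_pow, one_pow, smul_mul_assoc, one_mul]
  refine Matrix.ext fun a b => ?_
  rw [Matrix.smul_apply, hE k hk hkn, Matrix.sum_apply, Finset.sum_range, Fintype.sum_prod_type,
    Finset.smul_sum]
  refine Finset.sum_congr rfl fun i _ => ?_
  rw [hneg, smul_mul_assoc, Matrix.smul_apply, Matrix.mul_apply, Finset.smul_sum, Finset.smul_sum]
  refine Finset.sum_congr rfl fun c _ => ?_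
  rw [← algebraMap_smul ℂ (k : ℚ), map_natCast, smul_smul,
    show (k : ℂ) * ((-1) ^ (i : ℕ) / (k : ℂ)) = (-1) ^ (i : ℕ) by field_simp]

/-! ### The row blocks are admissible for the extended annotation -/

/-- The row blocks `L` (hypotheses of D4) form an admissible annotated gate list for the
annotation `K' j = K j` (`j < |L|`), `K' j = ∅` (`j ≥ |L|`) and the fan-in bound
`(n + w + 1)² + D + T + Eh ≥ n + w + D + T + Eh + 1`; heredity transfers because operands refer
to earlier gates. [folklore] -/
theorem rowScanProg_inv_rowBlocks (n w D T Eh : ℕ)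
    (L : List (ArithCircuit.Gate ℂ (Fin n × Fin n)))
    (K : ℕ → Finset (Fin n)) (hL1 : ∀ g ∈ L, g.args ≠ [])
    (hL2 : ∀ g ∈ L, g.fanIn ≤ n + w + D + T + Eh + 1)
    (hL3 : ∀ (i : ℕ) (g : ArithCircuit.Gate ℂ (Fin n × Fin n)), L[i]? = some g →
      ∀ u ∈ g.args, u.RefsBelow i)
    (hL5 : ∀ (i : ℕ) (us : List (ArithCircuit.Operand ℂ (Fin n × Fin n))),
      L[i]? = some (.prod us) → ∀ u ∈ us, SupportSymm.osupp K u ⊆ K i)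
    (hL6 : ∀ (i : ℕ) (σ : Equiv.Perm (Fin n)), i < L.length → (∀ x ∈ K i, σ x = x) →
      MvPolynomial.rename (fun pq : Fin n × Fin n => (σ pq.1, σ pq.2))
        ((ArithCircuit.gateValues L).getD i 0) = (ArithCircuit.gateValues L).getD i 0) :
    (∀ g ∈ L, g.args ≠ []) ∧
      (∀ g ∈ L, g.fanIn ≤ (n + w + 1) * (n + w + 1) + D + T + Eh) ∧
      (∀ (i : ℕ) (g : ArithCircuit.Gate ℂ (Fin n × Fin n)), L[i]? = some g →
        ∀ u ∈ g.args, u.RefsBelow i) ∧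
      (∀ (i : ℕ) (us : List (ArithCircuit.Operand ℂ (Fin n × Fin n))),
        L[i]? = some (.prod us) → ∀ u ∈ us,
          SupportSymm.osupp (fun j => if j < L.length then K j else ∅) u ⊆
            (fun j => if j < L.length then K j else ∅) i) ∧
      (∀ (i : ℕ) (σ : Equiv.Perm (Fin n)), i < L.length →
        (∀ x ∈ (fun j => if j < L.length then K j else ∅) i, σ x = x) →
        MvPolynomial.rename (fun pq : Fin n × Fin n => (σ pq.1, σ pq.2))
          ((ArithCircuit.gateValues L).getD i 0) = (ArithCircuit.gateValues L).getD i 0) := by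
  refine ⟨hL1, fun g hg => (hL2 g hg).trans ?_, hL3, ?_, ?_⟩
  · nlinarith [Nat.le_mul_self (n + w + 1)]
  · intro i us hi u hu
    have hi' : i < L.length := (List.getElem?_eq_some_iff.mp hi).1
    have h := hL5 i us hi u hu
    simp only [hi', if_true]
    cases u with
    | var pq => simpa [SupportSymm.osupp] using h
    | const c => simp [SupportSymm.osupp]
    | gate j =>
      have hj : j < i := hL3 i _ hi (.gate j) hu
      change (if j < L.length then K j else ∅) ⊆ K i
      rw [if_pos (hj.trans hi')]
      exact h
  · intro i σ hi hfix
    simp only [hi, if_true] at hfix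
    exact hL6 i σ hi hfix

/-! ### Size bookkeeping -/

/-- The global block has at most `(n + w + 2)^6` gates: `n w²` power-sum gates, `w²` gates for
`E_0`, `n (n w³ + w²)` Newton gates and one output gate. [folklore] -/
theorem rowScanProg_size_bound (n w : ℕ) :
    n * (w * w) + w * w + n * (n * (w * (w * w)) + w * w) + 1 ≤ (n + w + 2) ^ 6 := by
  have h1 : n ≤ n + w + 2 := by omega
  have h2 : w ≤ n + w + 2 := by omega
  obtain ⟨m, hm⟩ : ∃ m, m = n + w + 2 := ⟨_, rfl⟩
  rw [← hm] at h1 h2 ⊢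
  have hm2 : 2 ≤ m := by omega
  calc n * (w * w) + w * w + n * (n * (w * (w * w)) + w * w) + 1
      ≤ m * (m * m) + m * m + m * (m * (m * (m * m)) + m * m) + 1 := by gcongr
    _ = m ^ 5 + 2 * m ^ 3 + m ^ 2 + 1 := by ring
    _ ≤ m ^ 6 := by
      have k1 : 2 * m ^ 5 ≤ m ^ 6 := by
        rw [show m ^ 6 = m ^ 5 * m by ring]; exact Nat.mul_comm 2 _ ▸ Nat.mul_le_mul_left _ hm2
      have k2 : 4 * m ^ 3 ≤ m ^ 5 := by
        rw [show m ^ 5 = m ^ 3 * (m * m) by ring, Nat.mul_comm 4]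
        exact Nat.mul_le_mul_left _ (Nat.mul_le_mul hm2 hm2)
      have k3 : m ^ 2 ≤ m ^ 3 := Nat.pow_le_pow_right (by omega) (by norm_num)
      have k4 : 1 ≤ m ^ 3 := Nat.one_le_pow _ _ (by omega)
      omega

/-! ### The stub -/

/-- **D4 — the GLOBAL BLOCK of the scan program.** Given row blocks as in D3, append the invariant
gates (support `∅`): the power-sum matrices `P_{k+1} = Σ_i A_i^{k+1}`, Newton's recursion
`k • E_k = Σ_{i<k} (-1)^i E_{k-1-i} P_{i+1}` (weighted sums with coefficients `(-1)^i / k` and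
products of support-`∅` gates), and the output `Σ_{a,b} u_a (E_n)_{ab} v_b`. The result is a
supported program in the exact hypothesis format of
`SupportSymm.exists_symmetric_circuit_of_supports` (`k = 2`), computing `u · E_n · v` for SOME solution `E` of the recursion. [folklore] -/
theorem stub_rowScan_program (n w D T Eh : ℕ) (H : Fin w → Fin w → MvPolynomial (Fin D) ℂ)
    (u v : Fin w → ℂ)
    (L : List (ArithCircuit.Gate ℂ (Fin n × Fin n))) (K : ℕ → Finset (Fin n))
    (idx : Fin n → Fin n → Fin w → Fin w → ℕ)
    (hL1 : ∀ g ∈ L, g.args ≠ [])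
    (hL2 : ∀ g ∈ L, g.fanIn ≤ n + w + D + T + Eh + 1)
    (hL3 : ∀ (i : ℕ) (g : ArithCircuit.Gate ℂ (Fin n × Fin n)), L[i]? = some g →
      ∀ u ∈ g.args, u.RefsBelow i)
    (hL4 : ∀ i, (K i).card ≤ 2)
    (hL5 : ∀ (i : ℕ) (us : List (ArithCircuit.Operand ℂ (Fin n × Fin n))),
      L[i]? = some (.prod us) → ∀ u ∈ us, SupportSymm.osupp K u ⊆ K i)
    (hL6 : ∀ (i : ℕ) (σ : Equiv.Perm (Fin n)), i < L.length → (∀ x ∈ K i, σ x = x) →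
      MvPolynomial.rename (fun pq : Fin n × Fin n => (σ pq.1, σ pq.2))
        ((ArithCircuit.gateValues L).getD i 0) = (ArithCircuit.gateValues L).getD i 0)
    (hL7 : ∀ (i k : Fin n) (a b : Fin w), idx i k a b < L.length ∧ K (idx i k a b) = {i} ∧
      (ArithCircuit.gateValues L).getD (idx i k a b) 0 =
        ((Matrix.of fun a' b' : Fin w => MvPolynomial.aeval
            (fun d : Fin D => ∑ j : Fin n, (MvPolynomial.X (i, j) : MvPolynomial (Fin n × Fin n) ℂ)
              ^ ((d : ℕ) + 1)) (H a' b')) ^ ((k : ℕ) + 1)) a b) :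
    ∃ (P : ArithCircuit ℂ (Fin n × Fin n)) (K' : ℕ → Finset (Fin n))
      (E : ℕ → Matrix (Fin w) (Fin w) (MvPolynomial (Fin n × Fin n) ℂ)),
      (∀ g ∈ P.gates, g.args ≠ []) ∧
      (∀ g ∈ P.gates, g.fanIn ≤ (n + w + 1) * (n + w + 1) + D + T + Eh) ∧
      P.WellFormed ∧
      (∀ i, (K' i).card ≤ 2) ∧
      (∀ (i : ℕ) (us : List (ArithCircuit.Operand ℂ (Fin n × Fin n))),
        P.gates[i]? = some (.prod us) → ∀ u ∈ us, SupportSymm.osupp K' u ⊆ K' i) ∧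
      (∀ (i : ℕ) (σ : Equiv.Perm (Fin n)), i < P.size → (∀ x ∈ K' i, σ x = x) →
        MvPolynomial.rename (fun pq : Fin n × Fin n => (σ pq.1, σ pq.2))
          ((ArithCircuit.gateValues P.gates).getD i 0) =
          (ArithCircuit.gateValues P.gates).getD i 0) ∧
      (∃ j, P.output = .gate j ∧ j < P.size ∧ K' j = ∅) ∧
      P.size ≤ L.length + (n + w + 2) ^ 6 ∧
      E 0 = 1 ∧
      (∀ k : ℕ, 1 ≤ k → k ≤ n →
        (k : ℚ) • E k = ∑ i ∈ Finset.range k,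
          (-1 : Matrix (Fin w) (Fin w) (MvPolynomial (Fin n × Fin n) ℂ)) ^ i * E (k - 1 - i) *
          ∑ j : Fin n, (Matrix.of fun a' b' : Fin w => MvPolynomial.aeval
            (fun d : Fin D => ∑ j' : Fin n, (MvPolynomial.X (j, j') : MvPolynomial (Fin n × Fin n) ℂ)
              ^ ((d : ℕ) + 1)) (H a' b')) ^ (i + 1)) ∧
      P.eval = ∑ a : Fin w, ∑ b : Fin w,
        MvPolynomial.C (u a) * (E n) a b * MvPolynomial.C (v b) := by
  -- names (no definitions): the extended annotation, the fan-in bound, the transfer matrices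
  -- `A i`, the power-sum matrices `Pm i = Σ_j A_j^{i+1}`
  obtain ⟨K', hK'⟩ : ∃ K' : ℕ → Finset (Fin n),
      K' = fun j => if j < L.length then K j else ∅ := ⟨_, rfl⟩
  obtain ⟨B, hB⟩ : ∃ B : ℕ, B = (n + w + 1) * (n + w + 1) + D + T + Eh := ⟨_, rfl⟩
  obtain ⟨A, hA⟩ : ∃ A : Fin n → Matrix (Fin w) (Fin w) (MvPolynomial (Fin n × Fin n) ℂ),
      A = fun i => Matrix.of fun a' b' : Fin w => MvPolynomial.aeval
        (fun d : Fin D => ∑ j : Fin n, (MvPolynomial.X (i, j) : MvPolynomial (Fin n × Fin n) ℂ)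
          ^ ((d : ℕ) + 1)) (H a' b') := ⟨_, rfl⟩
  obtain ⟨Pm, hPm⟩ : ∃ Pm : ℕ → Matrix (Fin w) (Fin w) (MvPolynomial (Fin n × Fin n) ℂ),
      Pm = fun i => ∑ j, A j ^ (i + 1) := ⟨_, rfl⟩
  -- a solution of Newton's recursion, by strong recursion
  obtain ⟨E, hE0, hE⟩ : ∃ E : ℕ → Matrix (Fin w) (Fin w) (MvPolynomial (Fin n × Fin n) ℂ),
      E 0 = 1 ∧ ∀ m, 1 ≤ m → m ≤ n → ∀ a b, E m a b = ∑ ic : Fin m × Fin w,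
        ((-1 : ℂ) ^ (ic.1 : ℕ) / (m : ℂ)) • (E (m - 1 - ic.1) a ic.2 * Pm ic.1 ic.2 b) := by
    refine ⟨fun k => Nat.strongRec
      (motive := fun _ => Matrix (Fin w) (Fin w) (MvPolynomial (Fin n × Fin n) ℂ))
      (fun m ih => if hm : m = 0 then 1 else Matrix.of fun a b => ∑ ic : Fin m × Fin w,
        ((-1 : ℂ) ^ (ic.1 : ℕ) / (m : ℂ)) •
          (ih (m - 1 - ic.1) (by omega) a ic.2 * Pm ic.1 ic.2 b)) k, ?_, ?_⟩
    · dsimp only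
      rw [Nat.strongRec_eq, dif_pos rfl]
    · intro m hm _ a b
      dsimp only
      rw [Nat.strongRec_eq, dif_neg (by omega), Matrix.of_apply]
  -- arithmetic of the bounds
  have hK'0 : ∀ j, L.length ≤ j → K' j = ∅ := fun j hj => by simp [hK', not_lt.mpr hj]
  have hsq : n + w + 1 ≤ (n + w + 1) * (n + w + 1) := Nat.le_mul_self _
  have hB1 : n + 1 ≤ B := by rw [hB]; omega
  have hB0 : 1 ≤ B := by omega
  have hB2 : n * w + 1 ≤ B := by rw [hB]; nlinarith
  have hB3 : Fintype.card (Fin w × Fin w) + 1 ≤ B := by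
    simp only [Fintype.card_prod, Fintype.card_fin]; rw [hB]; nlinarith
  -- the row blocks
  have hIL : (∀ g ∈ L, g.args ≠ []) ∧ (∀ g ∈ L, g.fanIn ≤ B) ∧
      (∀ (i : ℕ) (g : ArithCircuit.Gate ℂ (Fin n × Fin n)), L[i]? = some g →
        ∀ u ∈ g.args, u.RefsBelow i) ∧
      (∀ (i : ℕ) (us : List (ArithCircuit.Operand ℂ (Fin n × Fin n))),
        L[i]? = some (.prod us) → ∀ u ∈ us, SupportSymm.osupp K' u ⊆ K' i) ∧
      (∀ (i : ℕ) (σ : Equiv.Perm (Fin n)), i < L.length → (∀ x ∈ K' i, σ x = x) →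
        MvPolynomial.rename (fun pq : Fin n × Fin n => (σ pq.1, σ pq.2))
          ((ArithCircuit.gateValues L).getD i 0) = (ArithCircuit.gateValues L).getD i 0) := by
    rw [hK', hB]
    exact rowScanProg_inv_rowBlocks n w D T Eh L K hL1 hL2 hL3 hL5 hL6
  have hAinv : ∀ (σ : Equiv.Perm (Fin n)) (m : ℕ) (a b : Fin w),
      MvPolynomial.rename (fun pq : Fin n × Fin n => (σ pq.1, σ pq.2)) (∑ j, (A j ^ m) a b) =
        ∑ j, (A j ^ m) a b := fun σ m a b => by
    rw [hA]; exact rowScanProg_psum_invariant H σ m a b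
  have hidx : ∀ (i k : Fin n) (a b : Fin w), idx i k a b < L.length ∧
      (ArithCircuit.gateValues L).getD (idx i k a b) 0 = (A i ^ ((k : ℕ) + 1)) a b :=
    fun i k a b => ⟨(hL7 i k a b).1, by rw [hA]; exact (hL7 i k a b).2.2⟩
  -- block 1: the power-sum matrices
  obtain ⟨G₁, p1, p2, p3, p4⟩ :=
    rowScanProg_blockP K' B hB1 A hAinv L idx hidx L List.prefix_rfl hIL
  -- block 2: `E_0` and Newton's recursion
  obtain ⟨G₂, q1, q2, q3, q4⟩ := rowScanProg_blockE0 K' B L.length hB0 G₁ p1.length_le p2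
  have hE0' : ∀ a b : Fin w, ∃ j, L.length ≤ j ∧ j < G₂.length ∧
      (ArithCircuit.gateValues G₂).getD j 0 = E 0 a b := fun a b => by
    rw [hE0]; exact q4 (a, b)
  have hPm' : ∀ i < n, ∀ c b : Fin w, ∃ j, L.length ≤ j ∧ j < G₂.length ∧
      (ArithCircuit.gateValues G₂).getD j 0 = Pm i c b := fun i hi c b => by
    rw [hPm]; exact rowScanProg_prov_mono q1 (p4 (⟨i, hi⟩, c, b))
  obtain ⟨G₃, r1, r2, r3, r4⟩ := rowScanProg_blockE K' B L.length hK'0 hB2 E Pm hE G₂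
    (p1.trans q1).length_le q2 hE0' hPm' n le_rfl
  -- block 3: the output gate
  obtain ⟨G₄, s1, s2, s3, jo, hjo1, hjo2, hjo3⟩ := rowScanProg_provide_wsum K' B L.length hK'0
    hB3 (fun e : Fin w × Fin w => u e.1 * v e.2) (fun e => E n e.1 e.2) G₃
    ((p1.trans q1).trans r1).length_le r2 (fun e => r4 n le_rfl e.1 e.2)
  have hout : ∑ e : Fin w × Fin w, (u e.1 * v e.2) • E n e.1 e.2 =
      ∑ a, ∑ b, MvPolynomial.C (u a) * E n a b * MvPolynomial.C (v b) := by
    rw [Fintype.sum_prod_type]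
    refine Finset.sum_congr rfl fun a _ => Finset.sum_congr rfl fun b _ => ?_
    rw [MvPolynomial.smul_eq_C_mul, map_mul]
    ring
  -- the program
  refine ⟨⟨G₄, .gate jo⟩, K', E, s2.1, hB ▸ s2.2.1, ⟨s2.2.2.1, hjo2⟩, fun i => ?_,
    s2.2.2.2.1, s2.2.2.2.2, ⟨jo, rfl, hjo2, hK'0 jo hjo1⟩, ?_, hE0, fun k hk hkn => ?_, ?_⟩
  · rw [hK']
    dsimp only
    split_ifs
    · exact hL4 i
    · simp
  · change G₄.length ≤ L.length + (n + w + 2) ^ 6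
    simp only [Fintype.card_prod, Fintype.card_fin] at p3 q3
    have := rowScanProg_size_bound n w
    omega
  · have h := rowScanProg_newton E Pm hE k hk hkn
    simp only [hPm, hA] at h
    exact h
  · change (ArithCircuit.Operand.gate jo).eval (ArithCircuit.gateValues G₄) = _
    rw [ArithCircuit.Operand.eval_gate, hjo3, hout]

end Summit.ValiantsHypothesis.ValiantsHypothesis.Theorems

end
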